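import Summits.CriticalPhenomena.PercolationContinuityZ3.Theorems.PercNearOneGluingNoHeavyLowerTailSahiPair43LinkProfile

/-!
# `NoHeavyLowerTail` (crux stmt-CriticalPhenomena-4575), Sahi programme: the cell `(4,3)` — **link, packed transport**: the packed greedy
# is a lane-wise sequence of downward transfers, so `packedTest` is sound

Support file (Sahi cell `prim-sahi`, seat `prim-sahi-typer` gen 31–32; `--supports stmt-CriticalPhenomena-4575`).  Pure proofs plus the
bookkeeping predicate `GState` (the invariant of the packed greedy); no `sorry`, standard axioms.

INVARIANT (`GState nb fA fB A B u`): the array `u` of 81 lane vectors has entries `u[x] = ofLanes nb (U x)` and, for every lane `i < nb`, there is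
an integer balance `β_i : ℕ → ℤ` on the codes with `U x i = BIAS + β_i x`, `β_i x ≥ −243`, `Σ_{x<81} β_i x ≤ 81·2^13`, and
`InDual (β_i ∘ enc) → InDual (yProfile (A i) (B i))`.  It holds for `packedProfile` (`gstate_init`, by `packedProfile_getD`/`profN_eq`), is
preserved by `pullStep` / `pullAll` / `packedGreedy` (each step is, lane by lane, `transfer` of `t_i = min(need_i, surplus_i)` from `w` down to
`y ≤ w` — `satsub_eq`, `lmin_eq`, `inDual_of_transfer`), and at the end `failLanes` reads off the lanes whose balances are not all `≥ 0`;
the others are in the dual cone by `inDual_of_nonneg`, the flagged ones by `pairTest_sound`.  **`packedTest_sound`**. [this work]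
-/

namespace Summit.CriticalPhenomena.PercolationContinuityZ3.Theorems.SahiGridPattern.Pair43

open Finset SahiGrid3 SahiGridPattern
open scoped BigOperators

/-! ### Table facts -/

/-- Entries of `upList[y]`: codes `< 81`, different from `y`, above `y`. [this work] -/
theorem mem_upList {y : ℕ} (hy : y < 81) {w : ℕ} (hw : w ∈ (upList.getD y #[]).toList) : w < 81 ∧ w ≠ y ∧ leC y w = true := by
  unfold upList at hw
  rw [SahiSlot34.getD_ofFn _ _ hy] at hw
  simp only [List.mem_flatMap, List.mem_filter, List.mem_range, Bool.and_eq_true, bne_iff_ne, ne_eq] at hw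
  obtain ⟨_, _, hw81, ⟨⟨_, hne⟩, hle⟩⟩ := hw
  exact ⟨hw81, hne, hle⟩

/-- Entries of `descOrd` are codes `< 81`. [this work] -/
theorem mem_descOrd {y : ℕ} (hy : y ∈ descOrd.toList) : y < 81 := by
  unfold descOrd at hy
  simp only [List.mem_flatMap, List.mem_filter, List.mem_range] at hy
  obtain ⟨_, _, hy81, _⟩ := hy
  exact hy81

/-! ### The invariant -/

/-- Lower bound of every balance. [this work] -/
def LOWB : ℤ := 243

/-- Upper bound of the total balance of a lane. [this work] -/
def TOTB : ℤ := 81 * 2 ^ 13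

/-- **The invariant of the packed greedy.** [this work] -/
structure GState (nb : ℕ) (A B : ℕ → Finset (Pd 4)) (u : Array ℕ) : Prop where
  size : u.size = 81
  lanes : ∃ U : ℕ → ℕ → ℕ, (∀ x < 81, u.getD x 0 = ofLanes nb (U x)) ∧
    ∀ i < nb, ∃ β : ℕ → ℤ, (∀ x < 81, (U x i : ℤ) = BIAS + β x) ∧ (∀ x < 81, -LOWB ≤ β x) ∧
      (∑ x ∈ range 81, β x) ≤ TOTB ∧ (InDual (fun p : Pd 4 => β (enc p)) → InDual (yProfile (A i) (B i)))

/-- Consequence of the invariant: every lane value is small (`< 2^21`). [this work] -/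
theorem lane_small {β : ℕ → ℤ} (hlow : ∀ x < 81, -LOWB ≤ β x) (htot : (∑ x ∈ range 81, β x) ≤ TOTB) {x : ℕ} (hx : x < 81) :
    β x ≤ TOTB + 80 * LOWB := by
  have hsplit := Finset.add_sum_erase (range 81) β (mem_range.2 hx)
  have hcard : ((range 81).erase x).card = 80 := by rw [Finset.card_erase_of_mem (mem_range.2 hx)]; simp
  have hrest : (80 : ℤ) * (-LOWB) ≤ ∑ z ∈ (range 81).erase x, β z := by
    have h := Finset.card_nsmul_le_sum ((range 81).erase x) β (-LOWB) fun z hz => hlow z (mem_range.1 (Finset.mem_of_mem_erase hz))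
    rw [hcard] at h; simpa using h
  linarith

/-- `BIAS + β` as a natural number, and its size. [this work] -/
theorem U_bound {U : ℕ} {βx : ℤ} (hU : (U : ℤ) = BIAS + βx) (hhi : βx ≤ TOTB + 80 * LOWB) : U < 2 ^ 21 := by
  unfold BIAS at hU; unfold LOWB TOTB at hhi
  have : (U : ℤ) < 2 ^ 21 := by rw [hU]; norm_num at hhi ⊢; linarith
  exact_mod_cast this

/-- `2^21 ≤ 2^GB`. [this work] -/
theorem pow21_le_GB : (2 : ℕ) ^ 21 ≤ 2 ^ GB := Nat.pow_le_pow_right (by omega) (by decide)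

/-- `BIAS < 2^GB`. [this work] -/
theorem BIAS_lt_GB : BIAS < 2 ^ GB := by unfold BIAS GB; norm_num

/-! ### The initial state -/

/-- **`packedProfile` satisfies the invariant.** [this work] -/
theorem gstate_init {nb : ℕ} {fA fB : ℕ → ℕ} {A B : ℕ → Finset (Pd 4)} (hA : ∀ i < nb, fA i < 2 ^ 81) (hB : ∀ i < nb, fB i < 2 ^ 81)
    (hrep : ∀ i < nb, Rep (fA i) (A i) ∧ Rep (fB i) (B i)) :
    GState nb A B (packedProfile (ones nb) (ofLanes nb fA) (ofLanes nb fB)) := by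
  refine ⟨by unfold packedProfile; simp, fun y i => profN fA fB y i, fun x hx => packedProfile_getD hA hB hx, fun i hi => ?_⟩
  refine ⟨fun x => (profN fA fB x i : ℤ) - BIAS, fun x _ => by ring, fun x hx => ?_, ?_, fun h => ?_⟩
  · have := (profN_parts_le fA fB x i).1
    unfold LOWB profN BIAS; push_cast; omega
  · have hb : ∀ x ∈ range 81, (profN fA fB x i : ℤ) - BIAS ≤ 2 ^ 13 := fun x _ => by
      have := profN_lt fA fB x i; unfold BIAS; push_cast; omega
    have := Finset.sum_le_card_nsmul (range 81) _ _ hb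
    unfold TOTB; simpa using this
  · have e : (fun p : Pd 4 => (profN fA fB (enc p) i : ℤ) - BIAS) = yProfile (A i) (B i) :=
      funext fun p => by rw [profN_eq (hrep i hi).1 (hrep i hi).2]; ring
    rwa [e] at h

/-! ### One pull step -/

/-- Reading an entry after `setIfInBounds` (natural-number arrays). [this work] -/
theorem getD_setIfInBounds_nat (c : Array ℕ) {i : ℕ} (hi : i < c.size) (v : ℕ) (j : ℕ) :
    (c.setIfInBounds i v).getD j 0 = if i = j then v else c.getD j 0 := by
  rw [Array.getD_eq_getD_getElem?, Array.getElem?_setIfInBounds, Array.getD_eq_getD_getElem?]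
  by_cases h : i = j
  · subst h; simp [hi]
  · simp [h]

/-- The constant lane vector `BIAS`. [this work] -/
theorem biasV_eq (nb : ℕ) : ones nb * BIAS = ofLanes nb (fun _ => BIAS) := by
  rw [ones_eq, ofLanes_mul]; exact ofLanes_congr fun _ _ => Nat.one_mul _

/-- Lane values in a `GState` are `< 2^GB`. [this work] -/
theorem lane_lt_GB {U : ℕ} {β : ℕ → ℤ} {x : ℕ} (hU : (U : ℤ) = BIAS + β x) (hlow : ∀ z < 81, -LOWB ≤ β z)
    (htot : (∑ z ∈ range 81, β z) ≤ TOTB) (hx : x < 81) : U < 2 ^ GB :=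
  (U_bound hU (lane_small hlow htot hx)).trans_le pow21_le_GB

/-- A nonzero lane vector is not `== 0`; conversely if `== 0` nothing happens.  (Only the shape of `pullStep` matters here.) [this work] -/
theorem pullStep_of_beq {one g biasV y : ℕ} {u : Array ℕ} {nv : ℕ} (w : ℕ) (h : (nv == 0) = true) :
    pullStep one g biasV y (u, nv) w = (u, nv) := by
  unfold pullStep; simp [h]

/-- **One pull step preserves the invariant** and keeps the remaining need a lane vector with lanes `≤ BIAS`. [this work] -/
theorem gstate_pullStep {nb : ℕ} {A B : ℕ → Finset (Pd 4)} {u : Array ℕ} (hs : GState nb A B u) {y w : ℕ} (hy : y < 81) (hw : w < 81)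
    (hne : w ≠ y) (hle : leC y w = true) {N : ℕ → ℕ} (hN : ∀ i < nb, N i ≤ BIAS) :
    GState nb A B (pullStep (ones nb) (ones nb <<< GB) (ones nb * BIAS) y (u, ofLanes nb N) w).1 ∧
      ∃ N' : ℕ → ℕ, (pullStep (ones nb) (ones nb <<< GB) (ones nb * BIAS) y (u, ofLanes nb N) w).2 = ofLanes nb N' ∧
        ∀ i < nb, N' i ≤ BIAS := by
  by_cases hz : (ofLanes nb N == 0) = true
  · rw [pullStep_of_beq w hz]; exact ⟨hs, N, rfl, hN⟩
  obtain ⟨hsize, U, hu, hl⟩ := hs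
  -- the lane functions of the step
  have hNlt : ∀ i < nb, N i < 2 ^ GB := fun i hi => (hN i hi).trans_lt BIAS_lt_GB
  have hUw : ∀ i < nb, U w i < 2 ^ GB := fun i hi => by
    obtain ⟨β, hU, hlow, htot, _⟩ := hl i hi; exact lane_lt_GB (hU w hw) hlow htot hw
  have hUy : ∀ i < nb, U y i < 2 ^ GB := fun i hi => by
    obtain ⟨β, hU, hlow, htot, _⟩ := hl i hi; exact lane_lt_GB (hU y hy) hlow htot hy
  let t : ℕ → ℕ := fun i => min (N i) (U w i - BIAS)
  have hhav : satsub (ones nb) (ones nb <<< GB) (u.getD w 0) (ones nb * BIAS) = ofLanes nb (fun i => U w i - BIAS) := by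
    rw [hu w hw, biasV_eq]; exact satsub_eq hUw (fun _ _ => BIAS_lt_GB)
  have ht : lmin (ones nb) (ones nb <<< GB) (ofLanes nb N) (ofLanes nb (fun i => U w i - BIAS)) = ofLanes nb t :=
    lmin_eq hNlt (fun i hi => (Nat.sub_le _ _).trans_lt (hUw i hi))
  have htle1 : ∀ i < nb, t i ≤ N i := fun i _ => Nat.min_le_left _ _
  have htle2 : ∀ i < nb, t i ≤ U w i - BIAS := fun i _ => Nat.min_le_right _ _
  -- unfold the step
  have hstep : pullStep (ones nb) (ones nb <<< GB) (ones nb * BIAS) y (u, ofLanes nb N) w =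
      (((u.setIfInBounds w (u.getD w 0 - ofLanes nb t)).setIfInBounds y (u.getD y 0 + ofLanes nb t)), ofLanes nb N - ofLanes nb t) := by
    unfold pullStep; rw [if_neg hz]; simp only []; rw [hhav, ht]
  rw [hstep]
  simp only []
  -- the new entries
  have hw81 : w < u.size := hsize ▸ hw
  have hy81 : y < (u.setIfInBounds w (u.getD w 0 - ofLanes nb t)).size := by simp [hsize, hy]
  have eW : u.getD w 0 - ofLanes nb t = ofLanes nb (fun i => U w i - t i) := by
    rw [hu w hw]; exact ofLanes_sub fun i hi => (htle2 i hi).trans (Nat.sub_le _ _)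
  have eY : u.getD y 0 + ofLanes nb t = ofLanes nb (fun i => U y i + t i) := by rw [hu y hy, ofLanes_add]
  let U' : ℕ → ℕ → ℕ := fun x => if x = y then (fun i => U y i + t i) else if x = w then (fun i => U w i - t i) else U x
  refine ⟨⟨by simp [hsize], U', fun x hx => ?_, fun i hi => ?_⟩, fun i => N i - t i, ofLanes_sub htle1,
    fun i hi => (Nat.sub_le _ _).trans (hN i hi)⟩
  · -- entries
    rw [getD_setIfInBounds_nat _ hy81]
    by_cases hxy : y = x
    · rw [if_pos hxy, eY]; subst hxy; simp [U']
    · rw [if_neg hxy, getD_setIfInBounds_nat _ hw81]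
      by_cases hxw : w = x
      · rw [if_pos hxw, eW]; subst hxw; simp [U', Ne.symm hxy]
      · rw [if_neg hxw, hu x hx]; simp [U', Ne.symm hxy, Ne.symm hxw]
  · -- balances of lane i
    obtain ⟨β, hU, hlow, htot, hdual⟩ := hl i hi
    have htw : t i ≤ U w i - BIAS := htle2 i hi
    have htw' : t i ≤ U w i := htw.trans (Nat.sub_le _ _)
    have hβw : (U w i : ℤ) = BIAS + β w := hU w hw
    -- the transferred amount is at most the positive part of the balance at `w`
    have ht_le : (t i : ℤ) ≤ max (β w) 0 := by
      by_cases hp : BIAS ≤ U w i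
      · have h1 : (t i : ℤ) ≤ (U w i : ℤ) - BIAS := by
          have := htw; zify [hp] at this; exact this
        have : (0 : ℤ) ≤ β w := by linarith [h1]
        rw [max_eq_left this]; linarith
      · have h0 : U w i - BIAS = 0 := Nat.sub_eq_zero_of_le (Nat.le_of_not_le hp)
        have : t i = 0 := Nat.eq_zero_of_le_zero (h0 ▸ htw)
        rw [this]; push_cast; exact le_max_right _ _
    refine ⟨fun x => β x - (if x = w then (t i : ℤ) else 0) + (if x = y then (t i : ℤ) else 0), fun x hx => ?_, fun x hx => ?_, ?_,
      fun hd => ?_⟩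
    · -- representation
      by_cases hxy : x = y
      · subst hxy
        simp only [U', if_true, if_neg (Ne.symm hne)]
        push_cast; rw [hU x hx]; ring
      · by_cases hxw : x = w
        · subst hxw
          simp only [U', if_neg hxy, if_true]
          rw [Nat.cast_sub htw', hU x hx]; ring
        · simp only [U', if_neg hxy, if_neg hxw]; rw [hU x hx]; ring
    · -- lower bound
      dsimp only
      have hb := hlow x hx
      have ht0 : (0 : ℤ) ≤ t i := Int.natCast_nonneg _
      by_cases hxw : x = w
      · subst hxw
        rw [if_pos rfl, if_neg hne]
        rcases le_or_gt 0 (β x) with hpos | hneg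
        · rw [max_eq_left hpos] at ht_le; unfold LOWB; linarith
        · rw [max_eq_right hneg.le] at ht_le; linarith
      · rw [if_neg hxw]
        by_cases hxy : x = y
        · rw [if_pos hxy]; linarith
        · rw [if_neg hxy]; linarith
    · -- total
      rw [Finset.sum_add_distrib, Finset.sum_sub_distrib, Finset.sum_ite_eq' (range 81) w, Finset.sum_ite_eq' (range 81) y,
        if_pos (mem_range.2 hw), if_pos (mem_range.2 hy)]
      linarith
    · -- dual cone: the new balance is a transfer of the old one
      obtain ⟨pw, hpw⟩ := exists_enc_eq hw
      obtain ⟨py, hpy⟩ := exists_enc_eq hy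
      apply hdual
      have hle' : py ≤ pw := (leC_enc py pw).1 (by rw [hpw, hpy]; exact hle)
      refine inDual_of_transfer hle' (Int.natCast_nonneg (t i)) ?_
      have e : transfer (fun p : Pd 4 => β (enc p)) pw py (t i) =
          fun p : Pd 4 => β (enc p) - (if enc p = w then (t i : ℤ) else 0) + (if enc p = y then (t i : ℤ) else 0) := by
        funext p
        unfold transfer
        have e1 : (p = pw) ↔ (enc p = w) := ⟨fun h => by rw [h, hpw], fun h => enc_injective (by rw [h, hpw])⟩
        have e2 : (p = py) ↔ (enc p = y) := ⟨fun h => by rw [h, hpy], fun h => enc_injective (by rw [h, hpy])⟩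
        simp only [e1, e2]
      rw [e]; exact hd

/-! ### All pulls of one point; the whole greedy -/

/-- A left fold preserves an invariant preserved by every step over the list. [this work] -/
theorem foldl_inv {α σ : Type} (P : σ → Prop) (f : σ → α → σ) (l : List α) (hf : ∀ x ∈ l, ∀ s, P s → P (f s x))
    (s : σ) (hs : P s) : P (l.foldl f s) := by
  induction l generalizing s with
  | nil => exact hs
  | cons x rest ih =>
    exact ih (fun z hz => hf z (List.mem_cons_of_mem x hz)) _ (hf x List.mem_cons_self s hs)

/-- **All pulls of one point preserve the invariant.** [this work] -/
theorem gstate_pullAll {nb : ℕ} {A B : ℕ → Finset (Pd 4)} {u : Array ℕ} (hs : GState nb A B u) {y : ℕ} (hy : y < 81) :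
    GState nb A B (pullAll (ones nb) (ones nb <<< GB) (ones nb * BIAS) u y) := by
  have hs' := hs
  obtain ⟨hsize, U, hu, hl⟩ := hs
  have hUy : ∀ i < nb, U y i < 2 ^ GB := fun i hi => by
    obtain ⟨β, hU, hlow, htot, _⟩ := hl i hi; exact lane_lt_GB (hU y hy) hlow htot hy
  have hneed : satsub (ones nb) (ones nb <<< GB) (ones nb * BIAS) (u.getD y 0) = ofLanes nb (fun i => BIAS - U y i) := by
    rw [hu y hy, biasV_eq]; exact satsub_eq (fun _ _ => BIAS_lt_GB) hUy
  unfold pullAll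
  simp only []
  rw [hneed]
  split
  · exact hs'
  · rw [← Array.foldl_toList]
    have H := foldl_inv
      (fun st : Array ℕ × ℕ => GState nb A B st.1 ∧ ∃ N : ℕ → ℕ, st.2 = ofLanes nb N ∧ ∀ i < nb, N i ≤ BIAS)
      (pullStep (ones nb) (ones nb <<< GB) (ones nb * BIAS) y) (upList.getD y #[]).toList
      (fun w hw st hst => by
        obtain ⟨hw81, hne, hle⟩ := mem_upList hy hw
        obtain ⟨st1, st2⟩ := st
        obtain ⟨hG, N, hN2, hNle⟩ := hst
        simp only at hG hN2
        subst hN2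
        exact gstate_pullStep hG hy hw81 hne hle hNle)
      (u, ofLanes nb fun i => BIAS - U y i) ⟨hs', _, rfl, fun i _ => Nat.sub_le _ _⟩
    exact H.1

/-- **The packed greedy preserves the invariant.** [this work] -/
theorem gstate_packedGreedy {nb : ℕ} {A B : ℕ → Finset (Pd 4)} {u : Array ℕ} (hs : GState nb A B u) :
    GState nb A B (packedGreedy (ones nb) u) := by
  unfold packedGreedy
  rw [← Array.foldl_toList]
  exact foldl_inv (GState nb A B) _ _ (fun y hy s hs => gstate_pullAll hs (mem_descOrd hy)) u hs

/-! ### `failLanes` reads off the lanes with a negative balance -/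

/-- OR of two `0/1` lanes. [this work] -/
theorem bit01_or (a b : Bool) : bit01 a ||| bit01 b = bit01 (a || b) := by
  cases a <;> cases b <;> simp [bit01]

/-- `1 ^^^ [b] = [¬b]`. [this work] -/
theorem one_xor_bit01 (b : Bool) : 1 ^^^ bit01 b = bit01 (!b) := by
  cases b <;> simp [bit01]

/-- `0/1` lanes are `< 2^LW`. [this work] -/
theorem bit01_lt_LW (b : Bool) : bit01 b < 2 ^ LW := lt_of_le_of_lt (bit01_le b) one_lt_two_pow_LW

/-- An OR-fold of `0/1` lane vectors is the lane vector of the disjunction. [this work] -/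
theorem foldBelow_or_lanes (nb n : ℕ) (F : ℕ → ℕ) (φ : ℕ → ℕ → Bool) (hF : ∀ y < n, F y = ofLanes nb (fun i => bit01 (φ y i))) :
    foldBelow n (fun y acc => acc ||| F y) 0 = ofLanes nb (fun i => bit01 ((List.range n).any fun y => φ y i)) := by
  induction n with
  | zero =>
    show 0 = _
    have : ofLanes nb (fun i => bit01 ((List.range 0).any fun y => φ y i)) = ofLanes nb (fun _ => 0) :=
      ofLanes_congr fun i _ => by simp [bit01]
    rw [this]; unfold ofLanes; simp
  | succ n ih =>
    show foldBelow n (fun y acc => acc ||| F y) 0 ||| F n = _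
    rw [ih (fun y hy => hF y (Nat.lt_succ_of_lt hy)), hF n (Nat.lt_succ_self n),
      ofLanes_or (fun i _ => bit01_lt_LW _) (fun i _ => bit01_lt_LW _)]
    refine ofLanes_congr fun i _ => ?_
    rw [bit01_or]
    simp only [List.range_succ, List.any_append, List.any_cons, List.any_nil, Bool.or_false]

/-- The term OR-ed in by `failLanes` at one point: the lanes whose value is below `BIAS`. [this work] -/
theorem failTerm_eq {nb : ℕ} {Uy : ℕ → ℕ} (hUy : ∀ i < nb, Uy i < 2 ^ GB) :
    ones nb ^^^ (((ofLanes nb Uy + (ones nb <<< GB) - ones nb * BIAS) >>> GB) &&& ones nb) =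
      ofLanes nb (fun i => bit01 (decide (Uy i < BIAS))) := by
  have hGB : (2 : ℕ) ^ GB < 2 ^ LW := Nat.pow_lt_pow_right (by omega) (by decide)
  have hd : ofLanes nb Uy + (ones nb <<< GB) - ones nb * BIAS = ofLanes nb (fun i => Uy i + 2 ^ GB - BIAS) := by
    rw [ones_eq, ofLanes_shiftLeft, ofLanes_add, ofLanes_mul, ofLanes_sub (fun i _ => ?_)]
    · exact ofLanes_congr fun i _ => by rw [Nat.one_mul, Nat.one_mul]
    · have := BIAS_lt_GB; rw [Nat.one_mul, Nat.one_mul]; omega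
  have hdb : ∀ i < nb, Uy i + 2 ^ GB - BIAS < 2 ^ LW := fun i hi => by
    have := hUy i hi; have := BIAS_lt_GB
    have h2 : 2 ^ GB + 2 ^ GB = 2 ^ (GB + 1) := by rw [Nat.pow_succ]; omega
    have h3 : (2 : ℕ) ^ (GB + 1) ≤ 2 ^ LW := Nat.pow_le_pow_right (by omega) GB_lt_LW
    omega
  rw [hd, extract_eq hdb (by decide : GB < LW), ones_eq, ofLanes_xor (fun _ _ => one_lt_two_pow_LW) (fun i _ => bit01_lt_LW _)]
  refine ofLanes_congr fun i hi => ?_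
  rw [testBit_guard (hUy i hi) BIAS_lt_GB, one_xor_bit01]
  congr 1
  by_cases h : BIAS ≤ Uy i
  · simp [h, Nat.not_lt_of_le h]
  · simp [h, Nat.lt_of_not_le h]

/-- **`failLanes` lane by lane**: lane `i` is `1` iff some entry of lane `i` is below `BIAS`. [this work] -/
theorem failLanes_eq {nb : ℕ} {u : Array ℕ} {U : ℕ → ℕ → ℕ} (hu : ∀ x < 81, u.getD x 0 = ofLanes nb (U x))
    (hUb : ∀ x < 81, ∀ i < nb, U x i < 2 ^ GB) :
    failLanes (ones nb) u = ofLanes nb (fun i => bit01 ((List.range 81).any fun y => decide (U y i < BIAS))) :=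
  foldBelow_or_lanes nb 81 (fun y => ones nb ^^^ (((u.getD y 0 + (ones nb <<< GB) - ones nb * BIAS) >>> GB) &&& ones nb))
    (fun y i => decide (U y i < BIAS)) fun y hy => by rw [hu y hy]; exact failTerm_eq (hUb y hy)

/-! ### Soundness of the batch test -/

/-- The finset of points represented by a mask. [this work] -/
def maskSet (a : ℕ) : Finset (Pd 4) := univ.filter fun p => a.testBit (enc p) = true

/-- A mask represents its finset. [this work] -/
theorem rep_maskSet (a : ℕ) : Rep a (maskSet a) := fun p => by
  unfold maskSet; simp only [mem_filter, mem_univ, true_and, Bool.decide_coe]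

/-- **Soundness of `packedTest`**: if a batch of representable pairs passes, the y-profile of every pair in it lies in the dual cone
of the up-sets. [this work] -/
theorem packedTest_sound {b : Batch} {fA fB : ℕ → ℕ} (hpa : b.pa = ofLanes b.n fA) (hpb : b.pb = ofLanes b.n fB)
    (hA : ∀ i < b.n, fA i < 2 ^ 81) (hB : ∀ i < b.n, fB i < 2 ^ 81) (h : packedTest b = true) :
    ∀ i < b.n, InDual (yProfile (maskSet (fA i)) (maskSet (fB i))) := by
  intro i hi
  have hA' : ∀ i < b.n, fA i < 2 ^ LW := fun i hi => (hA i hi).trans_le pow81_le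
  have hB' : ∀ i < b.n, fB i < 2 ^ LW := fun i hi => (hB i hi).trans_le pow81_le
  unfold packedTest at h
  rw [hpa, hpb] at h
  simp only [Bool.or_eq_true, beq_iff_eq] at h
  rcases h with h0 | h
  · omega
  -- the invariant through the greedy
  have hrep : ∀ i < b.n, Rep (fA i) (maskSet (fA i)) ∧ Rep (fB i) (maskSet (fB i)) :=
    fun i _ => ⟨rep_maskSet _, rep_maskSet _⟩
  have hG := gstate_packedGreedy (gstate_init (A := fun i => maskSet (fA i)) (B := fun i => maskSet (fB i)) hA hB hrep)
  obtain ⟨hsize, U, hu, hl⟩ := hG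
  have hUb : ∀ x < 81, ∀ i < b.n, U x i < 2 ^ GB := fun x hx i hi => by
    obtain ⟨β, hU, hlow, htot, _⟩ := hl i hi; exact lane_lt_GB (hU x hx) hlow htot hx
  have hfl := failLanes_eq hu hUb
  have key : (failLanes (ones b.n) (packedGreedy (ones b.n) (packedProfile (ones b.n) (ofLanes b.n fA) (ofLanes b.n fB)))).testBit
      (LW * i) = ((List.range 81).any fun y => decide (U y i < BIAS)) := by
    rw [hfl, show LW * i = LW * i + 0 from rfl, testBit_ofLanes (fun i _ => bit01_lt_LW _) i 0 LW_pos, testBit_bit01]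
    simp only [hi, decide_true, Bool.true_and, Bool.and_true]
  obtain ⟨β, hU, hlow, htot, hdual⟩ := hl i hi
  -- either lane `i` did not fail, or the one-pair test passed
  have hcase : ((List.range 81).any fun y => decide (U y i < BIAS)) = false ∨ pairTest (fA i) (fB i) = true := by
    rcases h with h1 | h2
    · left
      have e := key
      rw [h1, Nat.zero_testBit] at e
      exact e.symm
    · rw [allBelow_iff] at h2
      have h3 := h2 i hi
      rw [Bool.or_eq_true, Bool.not_eq_true', key, laneOf_ofLanes hA' hi, laneOf_ofLanes hB' hi] at h3
      exact h3
  rcases hcase with hall | hpt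
  · apply hdual
    refine inDual_of_nonneg fun p => ?_
    have e := hU (enc p) (enc_lt p)
    have hge : BIAS ≤ U (enc p) i := Nat.le_of_not_lt fun hlt => by
      have : ((List.range 81).any fun y => decide (U y i < BIAS)) = true :=
        List.any_eq_true.2 ⟨enc p, List.mem_range.2 (enc_lt p), decide_eq_true hlt⟩
      rw [hall] at this; exact Bool.false_ne_true this
    have : (BIAS : ℤ) ≤ (U (enc p) i : ℤ) := by exact_mod_cast hge
    linarith
  · exact pairTest_sound (rep_maskSet _) (rep_maskSet _) hpt

end Summit.CriticalPhenomena.PercolationContinuityZ3.Theorems.SahiGridPattern.Pair43
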